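import Summits.RiemannHypothesis.RiemannHypothesis.Theorems.PfPersistenceEdgeLawPohozaevInequality
import HarnessLib

/-!
# The corner energy: the cut spill is negligible (pub-rhpf theory-2, gen 4, Part G1)

Mechanism/rigidity campaign; no RH claims. RH-free helper lemmas (item
stmt-RiemannHypothesis-19953, `--as helper`).

(R2) of `LayerRegularAt` asks that the sub-layer-scale energy `L_a(u,h) = ∫_{0<s≤h} ρ(s)D_s(σ_h)ds`
of the edge layer `σ_h = ũ·1_{a−h<|x|}` be `o(h)`. `D_s(σ_h)` has an ARTIFICIAL part (the spill
across the cuts `±(a−h)`, where `σ_h` jumps from `ũ` to `0`) and a CANONICAL part, the **corner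
increment** `𝒥(s,h) := ∫_{x, x+s ∈ layer} ‖ũ(x+s) − ũ(x)‖²`. PROVED here, from the sup bound of
ground states (tree) and `m_h/h → 0` (edge intensity):
* `0 ≤ D_s(σ_h) − 𝒥(s,h) ≤ min(4K²|s|, 2m_h)` (`weilIncrement_sub_corner_le_*`);
* `(L_a(u,h) − 𝒞_a(u,h))/h → 0` for the **corner energy** `𝒞_a(u,h) := ∫_{0<s≤h} ρ(s)𝒥(s,h)ds`
  (`tendsto_edgeLayerLocalEnergy_sub_cornerEnergy_div`); hence (R2) ⟺ `𝒞_a(u,h) = o(h)`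
  (`tendsto_cornerEnergy_div_iff`), and under (R3) the **corner formula** `𝒞_a(u,h)/h → V/a − I`
  (`tendsto_cornerEnergy_div_of_interiorRegular`): the Pohozaev defect is `a` times the corner
  mass rate of the energy measure `ρ(s)‖ũ(x+s) − ũ(x)‖² dx ds`.

Reference: E. Bombieri, *Remarks on Weil's quadratic functional in the theory of prime numbers,
I*, Rend. Mat. Acc. Lincei (9) 11 (2000) 183–233, §4 Thm 3, §6.
-/

set_option linter.dupNamespace false

noncomputable section

open MeasureTheory Set Filter
open scoped Topology

namespace Summit.RiemannHypothesis.RiemannHypothesis.Theorems.PfPersistence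

open Literature.NumberTheory.LFunctions
open Summit.RiemannHypothesis.RiemannHypothesis.Theorems.WeilWindowFlowWindowLipschitz
  (stub_commutatorBound_measurableSet_shell stub_commutatorBound_volume_real_shell_le
    stub_commutatorBound_volume_shell_ne_top)

variable {a : ℝ} {u : ℝ → ℂ}

/-- The **corner increment** `𝒥(s,h) := ∫_{a−h<|x|, a−h<|x+s|} ‖ũ(x+s) − ũ(x)‖²`: increments of
`ũ` with both feet in the layer set. [cite: Bombieri2000Weil, §4 Thm 3] -/
def cornerIncrement (a : ℝ) (u : ℝ → ℂ) (h s : ℝ) : ℝ :=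
  ∫ x in {x : ℝ | a - h < |x| ∧ a - h < |x + s|}, ‖weilTrunc a u (x + s) - weilTrunc a u x‖ ^ 2

/-- The **corner energy** `𝒞_a(u,h) := ∫_{0<s≤h} ρ(s) 𝒥(s,h) ds`.
[cite: Bombieri2000Weil, §4 Thm 3] -/
def cornerEnergy (a : ℝ) (u : ℝ → ℂ) (h : ℝ) : ℝ :=
  ∫ s in Ioc 0 h, weilArchDensity s * cornerIncrement a u h s

/-- The corner set is measurable. [folklore] -/
theorem measurableSet_corner (a h s : ℝ) :
    MeasurableSet {x : ℝ | a - h < |x| ∧ a - h < |x + s|} :=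
  (measurableSet_lt measurable_const continuous_abs.measurable).inter
    (measurableSet_lt measurable_const ((continuous_id.add continuous_const).abs).measurable)

/-- `𝒥(s,h) ≥ 0`. [folklore] -/
theorem cornerIncrement_nonneg (h s : ℝ) : 0 ≤ cornerIncrement a u h s :=
  setIntegral_nonneg (measurableSet_corner a h s) fun _ _ ↦ by positivity

/-- Square-integrability of the increments of the truncation. [folklore] -/
theorem integrable_norm_sq_sub_weilTrunc (hu : IsWeilGroundState a u) (s : ℝ) :
    Integrable fun x ↦ ‖weilTrunc a u (x + s) - weilTrunc a u x‖ ^ 2 := by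
  have hv2 : MemLp (weilTrunc a u) 2 := (isWeilGroundState_weilTrunc hu).memLp
  have hm : MemLp (fun x ↦ weilTrunc a u (x + s) - weilTrunc a u x) 2 :=
    (hv2.comp_measurePreserving (measurePreserving_add_right volume s)).sub hv2
  exact (memLp_two_iff_integrable_sq_norm hm.1).1 hm

/-- Square-integrability of the increments of the layer function. [folklore] -/
theorem integrable_norm_sq_sub_weilEdgeLayer (hu : IsWeilGroundState a u) (h s : ℝ) :
    Integrable fun x ↦ ‖weilEdgeLayer a u h (x + s) - weilEdgeLayer a u h x‖ ^ 2 := by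
  have hv2 := memLp_weilEdgeLayer hu h
  have hm : MemLp (fun x ↦ weilEdgeLayer a u h (x + s) - weilEdgeLayer a u h x) 2 :=
    (hv2.comp_measurePreserving (measurePreserving_add_right volume s)).sub hv2
  exact (memLp_two_iff_integrable_sq_norm hm.1).1 hm

/-- **Lower bound**: `𝒥(s,h) ≤ D_s(σ_h)` (on the corner set `σ_h = ũ` at both feet). [folklore] -/
theorem cornerIncrement_le_weilIncrement (hu : IsWeilGroundState a u) (h s : ℝ) :
    cornerIncrement a u h s ≤ weilIncrement (weilEdgeLayer a u h) s := by
  unfold cornerIncrement weilIncrement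
  have heq : ∫ x in {x : ℝ | a - h < |x| ∧ a - h < |x + s|},
      ‖weilTrunc a u (x + s) - weilTrunc a u x‖ ^ 2 =
      ∫ x in {x : ℝ | a - h < |x| ∧ a - h < |x + s|},
        ‖weilEdgeLayer a u h (x + s) - weilEdgeLayer a u h x‖ ^ 2 :=
    setIntegral_congr_fun (measurableSet_corner a h s)
      (fun x (hx : a - h < |x| ∧ a - h < |x + s|) ↦ by
        rw [weilEdgeLayer_apply_of_lt hx.1, weilEdgeLayer_apply_of_lt hx.2])
  rw [heq]
  exact setIntegral_le_integral (integrable_norm_sq_sub_weilEdgeLayer hu h s)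
    (Eventually.of_forall fun _ ↦ by positivity)

/-- **Pointwise upper bound**: with the collar `C = {a − h < |y| ≤ a − h + |s|}`,
`‖σ_h(x+s) − σ_h(x)‖² ≤ 1_{corner}(x)‖ũ(x+s) − ũ(x)‖² + 1_C(x)‖ũ(x)‖² + 1_C(x+s)‖ũ(x+s)‖²`.
[folklore] -/
theorem norm_sq_sub_weilEdgeLayer_le_corner (h s x : ℝ) :
    ‖weilEdgeLayer a u h (x + s) - weilEdgeLayer a u h x‖ ^ 2 ≤
      {x : ℝ | a - h < |x| ∧ a - h < |x + s|}.indicator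
          (fun y ↦ ‖weilTrunc a u (y + s) - weilTrunc a u y‖ ^ 2) x +
        {y : ℝ | a - h < |y| ∧ |y| ≤ a - (h - |s|)}.indicator (fun y ↦ ‖weilTrunc a u y‖ ^ 2) x +
        {y : ℝ | a - h < |y| ∧ |y| ≤ a - (h - |s|)}.indicator (fun y ↦ ‖weilTrunc a u y‖ ^ 2)
          (x + s) := by
  set A : Set ℝ := {x : ℝ | a - h < |x| ∧ a - h < |x + s|} with hA
  set C : Set ℝ := {y : ℝ | a - h < |y| ∧ |y| ≤ a - (h - |s|)} with hC
  have hA0 : 0 ≤ A.indicator (fun y ↦ ‖weilTrunc a u (y + s) - weilTrunc a u y‖ ^ 2) x :=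
    Set.indicator_nonneg (fun _ _ ↦ by positivity) _
  have hC0 : ∀ z, 0 ≤ C.indicator (fun y ↦ ‖weilTrunc a u y‖ ^ 2) z := fun z ↦
    Set.indicator_nonneg (fun _ _ ↦ by positivity) _
  have hxs1 : |x + s| ≤ |x| + |s| := abs_add_le x s
  have hxs2 : |x| ≤ |x + s| + |s| := by
    have := abs_sub (x + s) s
    rwa [add_sub_cancel_right] at this
  by_cases hx : a - h < |x| <;> by_cases hxs : a - h < |x + s|
  · rw [weilEdgeLayer_apply_of_lt hx, weilEdgeLayer_apply_of_lt hxs,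
      Set.indicator_of_mem (show x ∈ A from ⟨hx, hxs⟩)]
    linarith [hC0 x, hC0 (x + s)]
  · rw [weilEdgeLayer_apply_of_lt hx, weilEdgeLayer_apply_of_le (not_lt.1 hxs), zero_sub,
      norm_neg, Set.indicator_of_mem (show x ∈ C from ⟨hx, by linarith [not_lt.1 hxs]⟩)]
    linarith [hA0, hC0 (x + s)]
  · rw [weilEdgeLayer_apply_of_le (not_lt.1 hx), weilEdgeLayer_apply_of_lt hxs, sub_zero,
      Set.indicator_of_mem (show x + s ∈ C from ⟨hxs, by linarith [not_lt.1 hx]⟩)]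
    linarith [hA0, hC0 x]
  · rw [weilEdgeLayer_apply_of_le (not_lt.1 hx), weilEdgeLayer_apply_of_le (not_lt.1 hxs),
      sub_zero, norm_zero, zero_pow two_ne_zero]
    linarith [hA0, hC0 x, hC0 (x + s)]

/-- **Upper bound**: `D_s(σ_h) ≤ 𝒥(s,h) + 2 ∫_C ‖ũ‖²`, `C = {a − h < |y| ≤ a − h + |s|}`.
[folklore] -/
theorem weilIncrement_le_corner_add (hu : IsWeilGroundState a u) (h s : ℝ) :
    weilIncrement (weilEdgeLayer a u h) s ≤ cornerIncrement a u h s +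
      2 * ∫ y in {y : ℝ | a - h < |y| ∧ |y| ≤ a - (h - |s|)}, ‖weilTrunc a u y‖ ^ 2 := by
  set A : Set ℝ := {x : ℝ | a - h < |x| ∧ a - h < |x + s|} with hA
  set C : Set ℝ := {y : ℝ | a - h < |y| ∧ |y| ≤ a - (h - |s|)} with hC
  have hAm : MeasurableSet A := measurableSet_corner a h s
  have hCm : MeasurableSet C := stub_commutatorBound_measurableSet_shell a (h - |s|) h
  have hv2 : MemLp (weilTrunc a u) 2 := (isWeilGroundState_weilTrunc hu).memLp
  have hi2 : Integrable fun x ↦ ‖weilTrunc a u x‖ ^ 2 :=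
    (memLp_two_iff_integrable_sq_norm hv2.1).1 hv2
  have hd2 := integrable_norm_sq_sub_weilTrunc hu s
  have hIA : Integrable (A.indicator fun y ↦ ‖weilTrunc a u (y + s) - weilTrunc a u y‖ ^ 2) :=
    hd2.indicator hAm
  have hIC : Integrable (C.indicator fun y ↦ ‖weilTrunc a u y‖ ^ 2) := hi2.indicator hCm
  have hICs : Integrable fun x ↦ C.indicator (fun y ↦ ‖weilTrunc a u y‖ ^ 2) (x + s) :=
    hIC.comp_add_right s
  have hsum : Integrable fun x ↦
      A.indicator (fun y ↦ ‖weilTrunc a u (y + s) - weilTrunc a u y‖ ^ 2) x +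
        C.indicator (fun y ↦ ‖weilTrunc a u y‖ ^ 2) x := hIA.add hIC
  unfold weilIncrement cornerIncrement
  calc ∫ x, ‖weilEdgeLayer a u h (x + s) - weilEdgeLayer a u h x‖ ^ 2
      ≤ ∫ x, (A.indicator (fun y ↦ ‖weilTrunc a u (y + s) - weilTrunc a u y‖ ^ 2) x +
          C.indicator (fun y ↦ ‖weilTrunc a u y‖ ^ 2) x +
          C.indicator (fun y ↦ ‖weilTrunc a u y‖ ^ 2) (x + s)) :=
        integral_mono_of_nonneg (Eventually.of_forall fun _ ↦ by positivity)
          ((hIA.add hIC).add hICs)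
          (Eventually.of_forall fun x ↦ norm_sq_sub_weilEdgeLayer_le_corner h s x)
    _ = (∫ x in A, ‖weilTrunc a u (x + s) - weilTrunc a u x‖ ^ 2) +
          (∫ y in C, ‖weilTrunc a u y‖ ^ 2) + ∫ y in C, ‖weilTrunc a u y‖ ^ 2 := by
        rw [integral_add hsum hICs, integral_add hIA hIC, integral_indicator hAm,
          integral_indicator hCm,
          integral_add_right_eq_self (C.indicator fun y ↦ ‖weilTrunc a u y‖ ^ 2) s,
          integral_indicator hCm]
    _ = _ := by ring

/-- The collar integral is at most `2K²|s|` under a sup bound (collar measure `≤ 2|s|`).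
[folklore] -/
theorem collar_integral_le_of_sup (hu : IsWeilGroundState a u) {K : ℝ}
    (hK : ∀ᵐ x : ℝ, ‖u x‖ ≤ K) (h s : ℝ) :
    ∫ y in {y : ℝ | a - h < |y| ∧ |y| ≤ a - (h - |s|)}, ‖weilTrunc a u y‖ ^ 2 ≤
      2 * K ^ 2 * |s| := by
  set C : Set ℝ := {y : ℝ | a - h < |y| ∧ |y| ≤ a - (h - |s|)} with hC
  have hCm : MeasurableSet C := stub_commutatorBound_measurableSet_shell a (h - |s|) h
  have hvol : volume.real C ≤ 2 * |s| := by
    have := stub_commutatorBound_volume_real_shell_le a (h - |s|) h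
    have e : max (h - (h - |s|)) 0 = |s| := by
      rw [max_eq_left (by linarith [abs_nonneg s])]; ring
    rwa [e] at this
  have hb : ∀ᵐ x ∂(volume.restrict C), ‖(‖weilTrunc a u x‖ ^ 2 : ℝ)‖ ≤ K ^ 2 := by
    refine ae_restrict_of_ae ?_
    filter_upwards [hK] with x hx
    rw [Real.norm_of_nonneg (by positivity)]
    exact pow_le_pow_left₀ (norm_nonneg _) ((norm_weilTrunc_le x).trans hx) 2
  have := norm_setIntegral_le_of_norm_le_const_ae
    (lt_top_iff_ne_top.2 (stub_commutatorBound_volume_shell_ne_top a (h - |s|) h)) hb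
  rw [Real.norm_of_nonneg (setIntegral_nonneg hCm fun _ _ ↦ by positivity)] at this
  have _ := hu.pos
  nlinarith [this, hvol, sq_nonneg K]

/-- The collar integral is at most the layer mass `m_h` (the collar lies in the layer).
[folklore] -/
theorem collar_integral_le_edgeMass (hu : IsWeilGroundState a u) (h s : ℝ) :
    ∫ y in {y : ℝ | a - h < |y| ∧ |y| ≤ a - (h - |s|)}, ‖weilTrunc a u y‖ ^ 2 ≤
      edgeMass (weilTrunc a u) a h := by
  have hv2 : MemLp (weilTrunc a u) 2 := (isWeilGroundState_weilTrunc hu).memLp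
  have hi2 : Integrable fun x ↦ ‖weilTrunc a u x‖ ^ 2 :=
    (memLp_two_iff_integrable_sq_norm hv2.1).1 hv2
  unfold edgeMass
  exact setIntegral_mono_set hi2.integrableOn (Eventually.of_forall fun _ ↦ by positivity)
    (Eventually.of_forall fun y (hy : a - h < |y| ∧ |y| ≤ a - (h - |s|)) ↦ hy.1)

/-- **The cut spill is small, I**: `0 ≤ D_s(σ_h) − 𝒥(s,h) ≤ 4K²|s|`. [folklore] -/
theorem weilIncrement_sub_corner_le_mul_abs (hu : IsWeilGroundState a u) {K : ℝ}
    (hK : ∀ᵐ x : ℝ, ‖u x‖ ≤ K) (h s : ℝ) :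
    weilIncrement (weilEdgeLayer a u h) s - cornerIncrement a u h s ≤ 4 * K ^ 2 * |s| := by
  have h1 := weilIncrement_le_corner_add hu h s
  have h2 := collar_integral_le_of_sup hu hK h s
  linarith

/-- **The cut spill is small, II**: `D_s(σ_h) − 𝒥(s,h) ≤ 2 m_h`. [folklore] -/
theorem weilIncrement_sub_corner_le_edgeMass (hu : IsWeilGroundState a u) (h s : ℝ) :
    weilIncrement (weilEdgeLayer a u h) s - cornerIncrement a u h s ≤
      2 * edgeMass (weilTrunc a u) a h := by
  have h1 := weilIncrement_le_corner_add hu h s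
  have h2 := collar_integral_le_edgeMass hu h s
  linarith

/-- `s ↦ 𝒥(s,h)` is measurable (via a measurable modification of `u` and measurability of
parametric integrals on the product). [folklore] -/
theorem measurable_cornerIncrement (hu : IsWeilGroundState a u) (h : ℝ) :
    Measurable (cornerIncrement a u h) := by
  have hum : AEStronglyMeasurable u volume := hu.memLp.1
  set v : ℝ → ℂ := hum.mk u with hv
  have hvm : Measurable v := hum.stronglyMeasurable_mk.measurable
  have huv : u =ᵐ[volume] v := hum.ae_eq_mk
  have htm : Measurable (weilTrunc a v) := hvm.indicator measurableSet_Ioo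
  have htuv : weilTrunc a u =ᵐ[volume] weilTrunc a v :=
    show (Ioo (-a) a).indicator u =ᵐ[volume] (Ioo (-a) a).indicator v from huv.indicator
  -- the jointly measurable integrand
  set G : ℝ × ℝ → ℝ := fun p ↦ {p : ℝ × ℝ | a - h < |p.2| ∧ a - h < |p.2 + p.1|}.indicator
    (fun p ↦ ‖weilTrunc a v (p.2 + p.1) - weilTrunc a v p.2‖ ^ 2) p with hG
  have hGm : Measurable G := by
    rw [hG]
    refine Measurable.indicator ?_ ?_
    · exact (((htm.comp (measurable_snd.add measurable_fst)).sub
        (htm.comp measurable_snd)).norm).pow_const 2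
    · exact (measurableSet_lt measurable_const
          (continuous_abs.measurable.comp measurable_snd)).inter
        (measurableSet_lt measurable_const
          (continuous_abs.measurable.comp (measurable_snd.add measurable_fst)))
  have hint : StronglyMeasurable fun s ↦ ∫ x, G (s, x) :=
    hGm.stronglyMeasurable.integral_prod_right'
  -- `𝒥(s, h) = ∫ x, G (s, x)` for every `s`
  have hfun : cornerIncrement a u h = fun s ↦ ∫ x, G (s, x) := by
    funext s
    have hshift : (fun x ↦ weilTrunc a u (x + s)) =ᵐ[volume] fun x ↦ weilTrunc a v (x + s) :=
      (measurePreserving_add_right volume s).quasiMeasurePreserving.ae_eq_comp htuv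
    unfold cornerIncrement
    rw [← integral_indicator (measurableSet_corner a h s)]
    refine integral_congr_ae ?_
    filter_upwards [htuv, hshift] with x hx hxs
    simp only [hG, Set.indicator_apply, Set.mem_setOf_eq, hx, hxs]
  rw [hfun]
  exact hint.measurable

/-- The corner energy density `ρ(s)𝒥(s,h)` is integrable on `(0, h]` (dominated by the layer's
energy density, finite by `integrableOn_arch_weilEdgeLayer`). [folklore] -/
theorem integrableOn_arch_cornerIncrement (hu : IsWeilGroundState a u) (h : ℝ) :
    IntegrableOn (fun s ↦ weilArchDensity s * cornerIncrement a u h s) (Ioc 0 h) := by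
  have hdom := (integrableOn_arch_weilEdgeLayer hu h).mono_set
    (Ioc_subset_Ioi_self : Ioc (0 : ℝ) h ⊆ Ioi 0)
  refine Integrable.mono' hdom
    ((measurable_weilArchDensity.mul (measurable_cornerIncrement hu h)).aestronglyMeasurable)
    ?_
  refine (ae_restrict_mem measurableSet_Ioc).mono fun s hs ↦ ?_
  have hρ := (weilArchDensity_pos hs.1).le
  rw [Real.norm_of_nonneg (mul_nonneg hρ (cornerIncrement_nonneg h s))]
  exact mul_le_mul_of_nonneg_left (cornerIncrement_le_weilIncrement hu h s) hρ

/-- `0 ≤ 𝒞_a(u,h) ≤ L_a(u,h)`. [folklore] -/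
theorem cornerEnergy_nonneg (h : ℝ) : 0 ≤ cornerEnergy a u h :=
  setIntegral_nonneg measurableSet_Ioc fun _ hs ↦
    mul_nonneg (weilArchDensity_pos hs.1).le (cornerIncrement_nonneg _ _)

/-- `𝒞_a(u,h) ≤ L_a(u,h)`. [folklore] -/
theorem cornerEnergy_le_edgeLayerLocalEnergy (hu : IsWeilGroundState a u) (h : ℝ) :
    cornerEnergy a u h ≤ edgeLayerLocalEnergy a u h :=
  setIntegral_mono_on (integrableOn_arch_cornerIncrement hu h)
    ((integrableOn_arch_weilEdgeLayer hu h).mono_set (Ioc_subset_Ioi_self : Ioc (0 : ℝ) h ⊆ Ioi 0))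
    measurableSet_Ioc
    fun s hs ↦ mul_le_mul_of_nonneg_left (cornerIncrement_le_weilIncrement hu h s)
      (weilArchDensity_pos hs.1).le

end Summit.RiemannHypothesis.RiemannHypothesis.Theorems.PfPersistence

end
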